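import Mathlib
import HarnessLib

/-!
# Crux `DivisionGap.ZeroOneTransfer` (stmt-ValiantsHypothesis-5066), line `charged-uncharged` —
registered stub `stub_zeroOne_ncard_le_two_pow_finrank`: FEW 0/1 VECTORS IN A LOW-DIMENSIONAL SPAN

**Claim settled** (stub C4 of the lead's skeleton, TRUE; folklore linear algebra): a finite set `S`
of real multivariate polynomials all of whose coefficients are `0` or `1` has at most `2 ^ r`
elements, `r = finrank ℝ (span ℝ S)`.

Proof (coordinate projection / dual basis), in the general form
`ZeroOneSpanCount.ncard_le_two_pow_finrank_span`: `V` a vector space over a field `K`,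
`c : ι → Dual K V` a JOINTLY INJECTIVE family of linear coordinates
(`(∀ i, c i v = 0) → v = 0`), `S ⊆ V` finite with all coordinates of its elements in `{0, 1}`.
Put `U := span K S` (finite-dimensional) and restrict the coordinates to `U`,
`φ i := (c i) ∘ U.subtype`.  Choose `B ⊆ range φ` linearly independent with
`span B = span (range φ)` (`exists_linearIndependent`); `B` is finite and
`|B| ≤ finrank (Dual K U) = finrank U` (`Subspace.dual_finrank_eq`).  Each `b ∈ B` is `φ (idx b)`
for some index `idx b`.  The encoding `S → (B → Bool)`, `g ↦ (b ↦ [c (idx b) g = 1])`, is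
injective on `S`: equal codes give equal coordinates `c (idx b) g = c (idx b) g'` (both lie in
`{0, 1}`), so every `b ∈ B` kills `u := g - g' ∈ U`; the annihilator
`ker (Dual.eval u) = {ψ | ψ u = 0}` is a subspace of `Dual K U` containing `B`, hence containing
`span B = span (range φ) ∋ φ i` for every `i`, so all coordinates of `g - g'` vanish and `g = g'`
by joint injectivity.  Therefore `|S| ≤ |B → Bool| = 2 ^ |B| ≤ 2 ^ finrank U`.  The stub is the
case `V = MvPolynomial σ ℝ`, `c m = MvPolynomial.lcoeff ℝ m` (joint injectivity =
`MvPolynomial.ext`).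

Unconditional (axioms `propext`, `Classical.choice`, `Quot.sound`).  Mathlib only; no citation
needed (folklore: a set of 0/1 vectors of rank `r` has at most `2 ^ r` elements, since `r` pivot
columns of its matrix determine every row).
-/

-- `Summit.ValiantsHypothesis.ValiantsHypothesis.…` is the tree's mandated layout (Sub = Summit).
set_option linter.dupNamespace false

namespace Summit.ValiantsHypothesis.ValiantsHypothesis.Theorems.DivisionGapZeroOneTransfer

namespace ZeroOneSpanCount

/-- **Few 0/1 vectors in a low-dimensional span** (general coordinate form).  If
`c : ι → Dual K V` is a jointly injective family of linear coordinates on a `K`-vector space `V`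
and `S ⊆ V` is a finite set all of whose elements have every `c`-coordinate in `{0, 1}`, then
`S.ncard ≤ 2 ^ finrank K (span K S)`: a linearly independent subfamily `B` of the coordinates
restricted to `span K S`, spanning the same subspace of the dual as all of them, has at most
`finrank (span K S)` members and is jointly injective on `span K S`, so `S` injects into
`B → Bool`. [folklore] -/
theorem ncard_le_two_pow_finrank_span {K V ι : Type*} [Field K] [AddCommGroup V] [Module K V]
    (c : ι → Module.Dual K V) (hc : ∀ v : V, (∀ i, c i v = 0) → v = 0)
    (S : Set V) (hS : S.Finite) (h01 : ∀ g ∈ S, ∀ i, c i g = 0 ∨ c i g = 1) :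
    S.ncard ≤ 2 ^ Module.finrank K (Submodule.span K S) := by
  classical
  haveI : FiniteDimensional K (Submodule.span K S) := FiniteDimensional.span_of_finite K hS
  -- the coordinates restricted to the span
  obtain ⟨φ, hφ⟩ : ∃ φ : ι → Module.Dual K (Submodule.span K S),
      ∀ i (u : Submodule.span K S), φ i u = c i (u : V) :=
    ⟨fun i => (c i).comp (Submodule.span K S).subtype, fun _ _ => rfl⟩
  -- a linearly independent subfamily of the restricted coordinates with the same span
  obtain ⟨B, hBsub, hBspan, hBli⟩ := exists_linearIndependent K (Set.range φ)
  have hBfin : B.Finite := hBli.setFinite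
  haveI : Finite B := hBfin.to_subtype
  have hcardB : Nat.card B ≤ Module.finrank K (Submodule.span K S) := by
    haveI : Fintype B := hBfin.fintype
    rw [Nat.card_eq_fintype_card, ← Subspace.dual_finrank_eq]
    exact hBli.fintype_card_le_finrank
  -- every member of `B` is a restricted coordinate `φ (idx b)`
  have hidx' : ∀ b ∈ B, ∃ i, φ i = b := fun b hb => hBsub hb
  choose idx hidx using hidx'
  -- the 0/1 encoding of `S` by the coordinates indexed by `B`
  let ev : V → B → Bool := fun g b => decide (c (idx b.1 b.2) g = 1)
  have hinj : Set.InjOn ev S := by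
    intro g hg g' hg' hev
    -- equal codes give equal `B`-coordinates (all coordinates lie in `{0, 1}`)
    have hco : ∀ (b) (hb : b ∈ B), c (idx b hb) g = c (idx b hb) g' := by
      intro b hb
      have hb' : (c (idx b hb) g = 1 ↔ c (idx b hb) g' = 1) := by
        have := congr_fun hev ⟨b, hb⟩
        simpa [ev] using this
      rcases h01 g hg (idx b hb) with h0 | h1 <;> rcases h01 g' hg' (idx b hb) with h0' | h1'
      · rw [h0, h0']
      · exact absurd (hb'.mpr h1') (by rw [h0]; exact zero_ne_one)
      · exact absurd (hb'.mp h1) (by rw [h0']; exact zero_ne_one)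
      · rw [h1, h1']
    have hp : g - g' ∈ Submodule.span K S :=
      Submodule.sub_mem _ (Submodule.subset_span hg) (Submodule.subset_span hg')
    -- every `b ∈ B`, hence all of `span B = span (range φ)`, kills `g - g'`
    have hker : Submodule.span K B ≤
        LinearMap.ker (Module.Dual.eval K (Submodule.span K S) ⟨g - g', hp⟩) := by
      rw [Submodule.span_le]
      intro b hb
      rw [SetLike.mem_coe, LinearMap.mem_ker, Module.Dual.eval_apply, ← hidx b hb, hφ,
        Submodule.coe_mk, map_sub, hco b hb, sub_self]
    -- so every coordinate of `g - g'` vanishes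
    refine sub_eq_zero.mp (hc _ fun i => ?_)
    have hi : φ i ∈ Submodule.span K B := by
      rw [hBspan]
      exact Submodule.subset_span ⟨i, rfl⟩
    have hki := hker hi
    rwa [LinearMap.mem_ker, Module.Dual.eval_apply, hφ, Submodule.coe_mk] at hki
  calc S.ncard ≤ (Set.univ : Set (B → Bool)).ncard :=
        Set.ncard_le_ncard_of_injOn ev (fun _ _ => Set.mem_univ _) hinj (Set.toFinite _)
    _ = 2 ^ Nat.card B := by
        rw [Set.ncard_univ, Nat.card_fun, Nat.card_eq_fintype_card (α := Bool), Fintype.card_bool]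
    _ ≤ 2 ^ Module.finrank K (Submodule.span K S) := Nat.pow_le_pow_right Nat.two_pos hcardB

end ZeroOneSpanCount

/-- **Stub C4 — FEW 0/1 VECTORS IN A LOW-DIMENSIONAL SPAN.**  A finite set `S` of real polynomials
all of whose coefficients are `0` or `1` has at most `2 ^ r` elements, `r` the dimension of its
real span: finitely many coefficient functionals restricted to `V = span S`, spanning the same
subspace of the dual of `V` as all of them, are at most `r` in number and jointly injective on `V`
(equivalently: a column basis `J`, `|J| ≤ r`, of the coefficient matrix of `S` determines every
row), and `S` injects into `{0,1}^J`.  Special case `c = MvPolynomial.lcoeff ℝ` of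
`ZeroOneSpanCount.ncard_le_two_pow_finrank_span`. [folklore] -/
theorem stub_zeroOne_ncard_le_two_pow_finrank :
    ∀ (σ : Type) (S : Set (MvPolynomial σ ℝ)), S.Finite →
      (∀ g ∈ S, ∀ m, MvPolynomial.coeff m g = 0 ∨ MvPolynomial.coeff m g = 1) →
      S.ncard ≤ 2 ^ Module.finrank ℝ (Submodule.span ℝ S) := by
  intro σ S hS h01
  refine ZeroOneSpanCount.ncard_le_two_pow_finrank_span
    (fun m : σ →₀ ℕ => MvPolynomial.lcoeff ℝ m) (fun v hv => ?_) S hS (fun g hg m => ?_)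
  · exact MvPolynomial.ext _ _ fun m => by simpa using hv m
  · simpa using h01 g hg m

end Summit.ValiantsHypothesis.ValiantsHypothesis.Theorems.DivisionGapZeroOneTransfer
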